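import Literature.Barriers.Parity.SiegelZeroPrimePairsFixedShiftII
import HarnessLib

/-!
# Matomäki–Merikoski Corollary 1.1(ii): the deduction from Theorem 1.3 for a GENERAL third rate

Sibling of `Literature/Barriers/Parity/SiegelZeroPrimePairsFixedShiftII.lean`, which PROVES Corollary
1.1(ii) of Matomäki–Merikoski (IMRN 2023; arXiv:2112.11412;
`Literature.Barriers.Parity.MatomakiMerikoski2023_fixedShift_ii`) from the weak form of Theorem 1.3 whose
third rate is the printed `V log⁶η/η`. Everything here is PROVED; no definition and no named fact is
introduced.

The printed deduction (arXiv p. 4, after Theorem 1.4: "For `X ≥ q^{10 log η}` the quantity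
`1/η = exp(−log η) ≫ exp(−√((log q)(log η))) ≫ exp(−√log X)` dominates `exp(−C(log X)^{3/5−ε})`
and `exp(−C V √log η)`, so also Corollary 1.1(ii) follows from Theorem 1.3") uses the third rate of
Theorem 1.3 only through `1/η ≪ V log⁶η/η`: the corollary's error term IS the third rate. This file
records the deduction for an ARBITRARY third rate `V·R(η)` with `1/η ≤ B·R(η)` (`η ≥ 10`):

* `MatomakiMerikoski2023_fixedShift_ii_generic_of_weakPairCorrelation_generic` — if Theorem 1.3 holds
  for positive shifts `h ≤ AX` with `C = 1` in the first rate, the classical second rate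
  `exp(−c₀ √log X)` (`c₀ > 0` fixed) and the third rate `V·R(η)`, then for every fixed `h ≥ 1`,
  `X = q^V`, `V ≥ 10 log η`: `∑_{n ≤ X} Λ(n)Λ(n+h) = X𝔖_h + O_h(X V R(η))` (**proved**; the proof of
  `MatomakiMerikoski2023_fixedShift_ii_of_weakPairCorrelation` verbatim: Siegel's theorem at the exponent
  `min(1/4, c₀²)`, `exp(−√(V log η)) ≤ 1/η`, `exp(−c₀√log X) ≤ e^{2|log D|+1}/η`
  (`MatomakiMerikoski.exp_neg_mul_sqrt_le_exp_div`), correction factor `≤ √(24h/q) ≤ √(24h)D²/η`).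
* `MatomakiMerikoski2023_fixedShift_ii_pow_of_weakPairCorrelation_pow` — the instance
  `R(η) = log^k η/η` (`k : ℕ`): third rate `V log^k η/η` ⟹ Corollary 1.1(ii) with `log^k η` in
  place of `log⁶η` (**proved**); at `k = 6` this is `MatomakiMerikoski2023_fixedShift_ii_of_weakPairCorrelation`.
* `MatomakiMerikoski2023_fixedShift_ii_rpow_of_weakPairCorrelation_rpow` — the instance
  `R(η) = η^{δ−1}` (`0 < δ`): third rate `V η^{δ−1}` ⟹ the corollary with error `O_h(X V η^{δ−1})`
  (**proved**).

Why the general rate is recorded (scope of the printed argument, stated here only as far as it can be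
checked on the page): the exponent `6` is produced in §7 of the source as `u⁶ V/η` with
`u = min{√(V log η)/(10C), log η}` ((7.1)), the power `u⁴` coming from Lemma 2.1, whose proof
(arXiv p. 10, lines 1–12) applies Lemma 3.1(ii) to the inner sum over `ℓ ≤ 4X/m` for every
`z ≤ m ≤ 4X/z`; Lemma 3.1 is stated for shifts `1 ≤ |h| ≤ X'^{10}` relative to the length `X'` of
the sum it bounds (arXiv p. 9), which for `X' = 4X/m` reads `m ≤ 4X/|h|^{1/10}`. A proof of
Theorem 1.3 that treats the remaining range `4X/|h|^{1/10} < m ≤ 4X/z` by a different bound may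
arrive at a different third rate; the theorems of this file turn any such rate into the corresponding
form of Corollary 1.1(ii).

## References

* K. Matomäki, J. Merikoski, *Siegel zeros, twin primes, Goldbach's conjecture, and primes in
  short intervals*, IMRN 2023:23, 20337–20384 (arXiv:2112.11412): Corollary 1.1(ii), Theorem 1.3,
  the deduction after Theorem 1.4 (p. 4), Lemma 2.1 and its proof (pp. 6, 9–10), (7.1) (p. 20).
  [cite: MatomakiMerikoski2023, Corollary 1.1(ii)]
* H. L. Montgomery, R. C. Vaughan, *Multiplicative Number Theory I*, Cambridge 2007, Cor. 11.15
  (Siegel's theorem; tree: `Literature.NumberTheory.LFunctions.Siegel.exists_one_sub_realZero_ge`).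
  [cite: MontgomeryVaughan2007, Corollary 11.15]
-/

noncomputable section

open Finset Real
open scoped ArithmeticFunction.vonMangoldt

namespace Literature.Barriers.Parity

set_option maxHeartbeats 800000 in
/-- **Matomäki–Merikoski 2023, Corollary 1.1(ii) from the weak form of Theorem 1.3 with a general
third rate.** Let `R : ℝ → ℝ` satisfy `1/η ≤ B R(η)` for `η ≥ 10` (`B > 0`). If Theorem 1.3 holds for
positive shifts `h ≤ A X` with `C = 1` in the first rate `exp(−√(V log η))`, the classical second rate
`exp(−c₀ √log X)` (`c₀ > 0` fixed) and the third rate `V R(η)`, then for every `h ≥ 1` there is `K`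
with `|∑_{n ≤ X} Λ(n)Λ(n+h) − X𝔖_h| ≤ K X V R(η)` whenever `X = q^V`, `V ≥ 10 log η` (`χ` primitive
quadratic mod `q ≥ 2` with `L(1 − 1/(η log q), χ) = 0`, `η ≥ 10`). The printed deduction (p. 4):
Siegel's theorem (`Siegel.exists_one_sub_realZero_ge` at the exponent `min(1/4, c₀²)`) gives
`exp(−c₀√log X) ≪ 1/η` for `V ≥ 10 log η` and bounds the correction factor by `√(24h) D²/η`;
`exp(−√(V log η)) ≤ 1/η`; and `1/η ≤ B R(η)`.
[cite: MatomakiMerikoski2023, Corollary 1.1(ii) and its proof after Theorem 1.4] -/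
theorem MatomakiMerikoski2023_fixedShift_ii_generic_of_weakPairCorrelation_generic
    {R : ℝ → ℝ} {B : ℝ} (hB : 0 < B) (hR : ∀ η : ℝ, 10 ≤ η → 1 / η ≤ B * R η)
    {c₀ : ℝ} (hc₀ : 0 < c₀)
    (h13 : ∀ A : ℝ, 0 < A → ∃ K : ℝ, 0 < K ∧
      ∀ (q : ℕ) [NeZero q], 2 ≤ q → ∀ χ : DirichletCharacter ℂ q, χ.IsPrimitive → χ.IsQuadratic →
        ∀ η : ℝ, 10 ≤ η → χ.LFunction ((1 - 1 / (η * Real.log q) : ℝ) : ℂ) = 0 →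
          ∀ V X : ℝ, 10 ≤ V → X = (q : ℝ) ^ V → ∀ h : ℕ, 1 ≤ h → (h : ℝ) ≤ A * X →
            |(∑ n ∈ Icc 1 ⌊X⌋₊, Λ n * Λ (n + h)) -
                X * Literature.NumberTheory.Sieve.goldbachSingularSeries h *
                  (1 + if Nat.totient (2 ^ padicValNat 2 q) ∣ h then
                        (-1 : ℝ) ^ (h / Nat.totient (2 ^ padicValNat 2 q)) *
                          ∏ p ∈ (q / 2 ^ padicValNat 2 q).primeFactors.filter (fun p => ¬ p ∣ h),
                            (-1 : ℝ) / ((p : ℝ) - 2)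
                      else 0)| ≤
              K * ((h : ℝ) / (Nat.totient h : ℝ)) * X *
                (Real.exp (-1 * Real.sqrt (V * Real.log η)) +
                  Real.exp (-c₀ * Real.sqrt (Real.log X)) + V * R η)) :
    ∀ h : ℕ, 1 ≤ h → ∃ K : ℝ, 0 < K ∧
      ∀ (q : ℕ) [NeZero q], 2 ≤ q → ∀ χ : DirichletCharacter ℂ q, χ.IsPrimitive → χ.IsQuadratic →
        ∀ η : ℝ, 10 ≤ η → χ.LFunction ((1 - 1 / (η * Real.log q) : ℝ) : ℂ) = 0 →
          ∀ V X : ℝ, 10 * Real.log η ≤ V → X = (q : ℝ) ^ V →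
            |(∑ n ∈ Icc 1 ⌊X⌋₊, Λ n * Λ (n + h)) -
                X * Literature.NumberTheory.Sieve.goldbachSingularSeries h| ≤
              K * X * (V * R η) := by
  intro h hh
  -- Siegel's theorem (MV Cor. 11.15) with exponent `ε_S = min(1/4, c₀²)`
  set εS : ℝ := min (1 / 4) (c₀ ^ 2) with hεSdef
  have hεS : 0 < εS := lt_min (by norm_num) (by positivity)
  have hεS4 : εS ≤ 1 / 4 := min_le_left _ _
  have hεSc : εS ≤ c₀ ^ 2 := min_le_right _ _
  obtain ⟨CS, hCS, hSiegel⟩ :=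
    Literature.NumberTheory.LFunctions.Siegel.exists_one_sub_realZero_ge hεS
  have hlog2 : 0 < Real.log 2 := Real.log_pos one_lt_two
  set D : ℝ := 1 / (CS * Real.log 2) with hDdef
  have hD : 0 < D := by positivity
  set M : ℝ := |Real.log D| with hMdef
  have hM : 0 ≤ M := abs_nonneg _
  set K₀ : ℝ := Real.exp (2 * M + 1) with hK₀def
  have hK₀ : 0 < K₀ := Real.exp_pos _
  -- the weak Theorem 1.3 with `A = h`
  have hh0 : (0 : ℝ) < h := by exact_mod_cast hh
  obtain ⟨K₁, hK₁, h13'⟩ := h13 h hh0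
  have htot : (0 : ℝ) < (Nat.totient h : ℝ) := by exact_mod_cast Nat.totient_pos.mpr hh
  set G : ℝ := Literature.NumberTheory.Sieve.goldbachSingularSeries h with hGdef
  refine ⟨K₁ * ((h : ℝ) / (Nat.totient h : ℝ)) * (1 + B + K₀ * B) + |G| * Real.sqrt (24 * h) * D ^ 2 * B,
    by positivity, ?_⟩
  intro q _ hq χ hprim hquad η hη hzero V X hVlo hX
  -- basic positivity
  have hq2 : (2 : ℝ) ≤ q := by exact_mod_cast hq
  have hq1 : (1 : ℝ) ≤ q := by linarith
  have hq0 : (0 : ℝ) < q := by linarith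
  have hlogq : Real.log 2 ≤ Real.log q := Real.log_le_log two_pos hq2
  have hlogq0 : 0 < Real.log q := lt_of_lt_of_le hlog2 hlogq
  have hη0 : (0 : ℝ) < η := by linarith
  have hη1 : (1 : ℝ) ≤ η := by linarith
  set L : ℝ := Real.log η with hLdef
  have hL1 : 1 ≤ L := by
    rw [hLdef, Real.le_log_iff_exp_le hη0]
    linarith [Real.exp_one_lt_three]
  have hL0 : 0 < L := by linarith
  have hV10 : 10 ≤ V := by
    have : (10 : ℝ) * 1 ≤ 10 * L := mul_le_mul_of_nonneg_left hL1 (by norm_num)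
    linarith
  have hV0 : 0 < V := by linarith
  have hLV : L ≤ V := by linarith
  have hX1 : 1 ≤ X := by rw [hX]; exact Real.one_le_rpow hq1 hV0.le
  have hX0 : 0 < X := by linarith
  have hlogX : Real.log X = V * Real.log q := by rw [hX, Real.log_rpow hq0]
  -- `χ ≠ 1`, `χ² = 1`
  have hne : χ ≠ 1 := by
    intro h1
    have := (DirichletCharacter.eq_one_iff_conductor_eq_one (χ := χ)).mp h1
    rw [hprim] at this
    omega
  -- Siegel: `η ≤ D q^{ε_S}`
  have hηD : η ≤ D * (q : ℝ) ^ εS := by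
    have hS := hSiegel q χ hquad.sq_eq_one hne (1 - 1 / (η * Real.log q)) hzero
    have hS' : CS * (q : ℝ) ^ (-εS) ≤ 1 / (η * Real.log q) := by linarith
    have hpos : 0 < CS * (q : ℝ) ^ (-εS) := by positivity
    have hηlog : η * Real.log q ≤ (q : ℝ) ^ εS / CS := by
      have := (le_one_div hpos (by positivity)).mp hS'
      calc η * Real.log q ≤ 1 / (CS * (q : ℝ) ^ (-εS)) := this
        _ = (q : ℝ) ^ εS / CS := by
            rw [Real.rpow_neg hq0.le]; field_simp
    calc η = η * Real.log q / Real.log q := by field_simp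
      _ ≤ ((q : ℝ) ^ εS / CS) / Real.log q := by gcongr
      _ ≤ ((q : ℝ) ^ εS / CS) / Real.log 2 := by gcongr
      _ = D * (q : ℝ) ^ εS := by rw [hDdef]; field_simp
  -- hence `η ≤ D q^{1/4}` and `log η ≤ |log D| + ε_S log q`
  have hηD4 : η ≤ D * (q : ℝ) ^ (1 / 4 : ℝ) :=
    hηD.trans (mul_le_mul_of_nonneg_left (Real.rpow_le_rpow_of_exponent_le hq1 hεS4) hD.le)
  have hLle : L ≤ M + εS * Real.log q := by
    calc L ≤ Real.log (D * (q : ℝ) ^ εS) := Real.log_le_log hη0 hηD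
      _ = Real.log D + εS * Real.log q := by
          rw [Real.log_mul hD.ne' (Real.rpow_pos_of_pos hq0 εS).ne', Real.log_rpow hq0]
      _ ≤ M + εS * Real.log q := by linarith [le_abs_self (Real.log D)]
  -- consequence: `1/√q ≤ D²/η`
  have hsqrtq : 1 / Real.sqrt q ≤ D ^ 2 / η := by
    have hq14sq : ((q : ℝ) ^ (1 / 4 : ℝ)) ^ 2 = Real.sqrt q := by
      rw [← Real.rpow_natCast, ← Real.rpow_mul hq0.le, Real.sqrt_eq_rpow]; norm_num
    have hη2 : η ^ 2 ≤ D ^ 2 * Real.sqrt q := by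
      calc η ^ 2 ≤ (D * (q : ℝ) ^ (1 / 4 : ℝ)) ^ 2 := pow_le_pow_left₀ hη0.le hηD4 2
        _ = D ^ 2 * Real.sqrt q := by rw [mul_pow, hq14sq]
    rw [div_le_div_iff₀ (Real.sqrt_pos.mpr hq0) hη0, one_mul]
    exact (le_self_pow₀ hη1 two_ne_zero).trans hη2
  -- the target error `T = V R(η)` dominates `1/η` (up to the factor `B`)
  set T : ℝ := V * R η with hTdef
  have hRη : 1 / η ≤ B * R η := hR η hη
  have hR0 : 0 < R η := by
    have h1 : 0 < 1 / η := by positivity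
    have h2 : 0 < B * R η := lt_of_lt_of_le h1 hRη
    exact (pos_iff_pos_of_mul_pos h2).mp hB
  have hTη : 1 / η ≤ B * T := by
    rw [hTdef]
    have : R η ≤ V * R η := le_mul_of_one_le_left hR0.le (by linarith)
    nlinarith [mul_le_mul_of_nonneg_left this hB.le, hRη]
  have hT0 : 0 < T := by rw [hTdef]; positivity
  -- E1 = exp(−√(V log η)) ≤ 1/η
  have hE1 : Real.exp (-1 * Real.sqrt (V * L)) ≤ 1 / η := by
    rw [neg_one_mul, Real.exp_neg, one_div, inv_le_inv₀ (Real.exp_pos _) hη0]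
    calc η = Real.exp L := (Real.exp_log hη0).symm
      _ ≤ Real.exp (Real.sqrt (V * L)) := Real.exp_le_exp.mpr ?_
    calc L = Real.sqrt (L ^ 2) := (Real.sqrt_sq hL0.le).symm
      _ ≤ Real.sqrt (V * L) :=
          Real.sqrt_le_sqrt (by rw [pow_two]; exact mul_le_mul_of_nonneg_right hLV hL0.le)
  -- E2 = exp(−c₀ √log X) ≤ K₀/η
  have hE2 : Real.exp (-c₀ * Real.sqrt (Real.log X)) ≤ K₀ / η := by
    rw [hlogX]
    have hV' : 10 * Real.log η ≤ V := by rw [← hLdef]; exact hVlo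
    exact MatomakiMerikoski.exp_neg_mul_sqrt_le_exp_div hc₀ hεSc hM hlogq0.le hη0 hLle hV'
  have hE2' : K₀ / η ≤ K₀ * B * T := by
    rw [div_eq_mul_one_div, mul_assoc]
    exact mul_le_mul_of_nonneg_left hTη hK₀.le
  -- the correction factor
  have hcorr := SiegelCorr.abs_corr_le (R := ℂ) χ hprim hquad hh
  have hcorr' : Real.sqrt (24 * h / q) ≤ Real.sqrt (24 * h) * D ^ 2 / η := by
    rw [Real.sqrt_div' _ hq0.le]
    calc Real.sqrt (24 * h) / Real.sqrt q = Real.sqrt (24 * h) * (1 / Real.sqrt q) := by ring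
      _ ≤ Real.sqrt (24 * h) * (D ^ 2 / η) := by gcongr
      _ = Real.sqrt (24 * h) * D ^ 2 / η := by ring
  have hcorrT : Real.sqrt (24 * h) * D ^ 2 / η ≤ Real.sqrt (24 * h) * D ^ 2 * B * T := by
    rw [div_eq_mul_one_div, mul_assoc (Real.sqrt (24 * h) * D ^ 2)]
    exact mul_le_mul_of_nonneg_left hTη (by positivity)
  -- Theorem 1.3 (weak form)
  have hhX : (h : ℝ) ≤ h * X := le_mul_of_one_le_right hh0.le hX1
  have hmain := h13' q hq χ hprim hquad η hη hzero V X hV10 hX h hh hhX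
  -- assemble
  set S : ℝ := ∑ n ∈ Icc 1 ⌊X⌋₊, Λ n * Λ (n + h) with hSdef
  set corr : ℝ := (if Nat.totient (2 ^ padicValNat 2 q) ∣ h then
        (-1 : ℝ) ^ (h / Nat.totient (2 ^ padicValNat 2 q)) *
          ∏ p ∈ (q / 2 ^ padicValNat 2 q).primeFactors.filter (fun p => ¬ p ∣ h),
            (-1 : ℝ) / ((p : ℝ) - 2)
      else 0) with hcorrdef
  have htri : |S - X * G| ≤ |S - X * G * (1 + corr)| + |X * G * (1 + corr) - X * G| :=
    abs_sub_le _ _ _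
  have hmid : |X * G * (1 + corr) - X * G| = X * |G| * |corr| := by
    rw [show X * G * (1 + corr) - X * G = X * G * corr by ring, abs_mul, abs_mul, abs_of_pos hX0]
  have hsum : Real.exp (-1 * Real.sqrt (V * L)) + Real.exp (-c₀ * Real.sqrt (Real.log X))
      + V * R η ≤ (1 + B + K₀ * B) * T := by
    rw [← hTdef]
    nlinarith [hE1, hTη, hE2, hE2']
  have hc0 : 0 ≤ K₁ * ((h : ℝ) / (Nat.totient h : ℝ)) * X := by positivity
  calc |S - X * G| ≤ |S - X * G * (1 + corr)| + |X * G * (1 + corr) - X * G| := htri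
    _ ≤ K₁ * ((h : ℝ) / (Nat.totient h : ℝ)) * X *
          (Real.exp (-1 * Real.sqrt (V * L)) + Real.exp (-c₀ * Real.sqrt (Real.log X))
            + V * R η) + X * |G| * |corr| := by
        rw [hmid]; exact add_le_add hmain le_rfl
    _ ≤ K₁ * ((h : ℝ) / (Nat.totient h : ℝ)) * X * ((1 + B + K₀ * B) * T) +
          X * |G| * (Real.sqrt (24 * h) * D ^ 2 * B * T) := by
        gcongr
        · exact (hcorr.trans hcorr').trans hcorrT
    _ = (K₁ * ((h : ℝ) / (Nat.totient h : ℝ)) * (1 + B + K₀ * B) + |G| * Real.sqrt (24 * h) * D ^ 2 * B)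
          * X * T := by ring
    _ = _ := by rw [hTdef]


/-- **Corollary 1.1(ii) with a general power of `log η`**: if Theorem 1.3 (weak form: `C = 1`,
classical second rate `exp(−c₀√log X)`) holds with the third rate `V log^k η/η`, then for every
`h ≥ 1`, `ε > 0` there is `K` with `|∑_{n ≤ X} Λ(n)Λ(n+h) − X𝔖_h| ≤ K X log^k η/(η/V)` for
`X = q^V`, `V ∈ [10 log η, η^{1−ε}]` — the statement of `MatomakiMerikoski2023_fixedShift_ii` with
`log^k η` in place of `log⁶ η` (instance `R(η) = log^k η/η` of the previous theorem: `log η ≥ 1`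
for `η ≥ 10`, so `1/η ≤ log^k η/η`; the constraint `V ≤ η^{1−ε}` is not used).
[cite: MatomakiMerikoski2023, Corollary 1.1(ii)] -/
theorem MatomakiMerikoski2023_fixedShift_ii_pow_of_weakPairCorrelation_pow (k : ℕ)
    {c₀ : ℝ} (hc₀ : 0 < c₀)
    (h13 : ∀ A : ℝ, 0 < A → ∃ K : ℝ, 0 < K ∧
      ∀ (q : ℕ) [NeZero q], 2 ≤ q → ∀ χ : DirichletCharacter ℂ q, χ.IsPrimitive → χ.IsQuadratic →
        ∀ η : ℝ, 10 ≤ η → χ.LFunction ((1 - 1 / (η * Real.log q) : ℝ) : ℂ) = 0 →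
          ∀ V X : ℝ, 10 ≤ V → X = (q : ℝ) ^ V → ∀ h : ℕ, 1 ≤ h → (h : ℝ) ≤ A * X →
            |(∑ n ∈ Icc 1 ⌊X⌋₊, Λ n * Λ (n + h)) -
                X * Literature.NumberTheory.Sieve.goldbachSingularSeries h *
                  (1 + if Nat.totient (2 ^ padicValNat 2 q) ∣ h then
                        (-1 : ℝ) ^ (h / Nat.totient (2 ^ padicValNat 2 q)) *
                          ∏ p ∈ (q / 2 ^ padicValNat 2 q).primeFactors.filter (fun p => ¬ p ∣ h),
                            (-1 : ℝ) / ((p : ℝ) - 2)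
                      else 0)| ≤
              K * ((h : ℝ) / (Nat.totient h : ℝ)) * X *
                (Real.exp (-1 * Real.sqrt (V * Real.log η)) +
                  Real.exp (-c₀ * Real.sqrt (Real.log X)) + V * Real.log η ^ k / η)) :
    ∀ h : ℕ, 1 ≤ h → ∀ ε : ℝ, 0 < ε → ∃ K : ℝ, 0 < K ∧
      ∀ (q : ℕ) [NeZero q], 2 ≤ q → ∀ χ : DirichletCharacter ℂ q, χ.IsPrimitive → χ.IsQuadratic →
        ∀ η : ℝ, 10 ≤ η → χ.LFunction ((1 - 1 / (η * Real.log q) : ℝ) : ℂ) = 0 →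
          ∀ V X : ℝ, 10 * Real.log η ≤ V → V ≤ η ^ (1 - ε) → X = (q : ℝ) ^ V →
            |(∑ n ∈ Icc 1 ⌊X⌋₊, Λ n * Λ (n + h)) -
                X * Literature.NumberTheory.Sieve.goldbachSingularSeries h| ≤
              K * X * (Real.log η ^ k / (η / V)) := by
  intro h hh ε _hε
  have hR : ∀ η : ℝ, 10 ≤ η → 1 / η ≤ 1 * (Real.log η ^ k / η) := by
    intro η hη
    have hη0 : 0 < η := by linarith
    have hL1 : 1 ≤ Real.log η := by
      rw [Real.le_log_iff_exp_le hη0]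
      linarith [Real.exp_one_lt_three]
    rw [one_mul]
    exact div_le_div_of_nonneg_right (one_le_pow₀ hL1) hη0.le
  have h13' : ∀ A : ℝ, 0 < A → ∃ K : ℝ, 0 < K ∧
      ∀ (q : ℕ) [NeZero q], 2 ≤ q → ∀ χ : DirichletCharacter ℂ q, χ.IsPrimitive → χ.IsQuadratic →
        ∀ η : ℝ, 10 ≤ η → χ.LFunction ((1 - 1 / (η * Real.log q) : ℝ) : ℂ) = 0 →
          ∀ V X : ℝ, 10 ≤ V → X = (q : ℝ) ^ V → ∀ h : ℕ, 1 ≤ h → (h : ℝ) ≤ A * X →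
            |(∑ n ∈ Icc 1 ⌊X⌋₊, Λ n * Λ (n + h)) -
                X * Literature.NumberTheory.Sieve.goldbachSingularSeries h *
                  (1 + if Nat.totient (2 ^ padicValNat 2 q) ∣ h then
                        (-1 : ℝ) ^ (h / Nat.totient (2 ^ padicValNat 2 q)) *
                          ∏ p ∈ (q / 2 ^ padicValNat 2 q).primeFactors.filter (fun p => ¬ p ∣ h),
                            (-1 : ℝ) / ((p : ℝ) - 2)
                      else 0)| ≤
              K * ((h : ℝ) / (Nat.totient h : ℝ)) * X *
                (Real.exp (-1 * Real.sqrt (V * Real.log η)) +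
                  Real.exp (-c₀ * Real.sqrt (Real.log X)) + V * (fun t => Real.log t ^ k / t) η) := by
    intro A hA
    obtain ⟨K, hK, H⟩ := h13 A hA
    refine ⟨K, hK, fun q _ hq χ hprim hquad η hη hzero V X hV hX h hh hhA => ?_⟩
    have := H q hq χ hprim hquad η hη hzero V X hV hX h hh hhA
    simpa only [mul_div_assoc] using this
  obtain ⟨K, hK, H⟩ :=
    MatomakiMerikoski2023_fixedShift_ii_generic_of_weakPairCorrelation_generic one_pos hR hc₀ h13' h hh
  refine ⟨K, hK, fun q _ hq χ hprim hquad η hη hzero V X hVlo _hVhi hX => ?_⟩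
  have hmain := H q hq χ hprim hquad η hη hzero V X hVlo hX
  have hη0 : 0 < η := by linarith
  have e : V * (Real.log η ^ k / η) = Real.log η ^ k / (η / V) := by
    rw [div_div_eq_mul_div]; ring
  simpa only [e] using hmain

/-- **Corollary 1.1(ii) with a power saving `η^{δ−1}`**: if Theorem 1.3 (weak form) holds with the
third rate `V η^{δ−1}` (`δ > 0`), then for every `h ≥ 1` there is `K` with
`|∑_{n ≤ X} Λ(n)Λ(n+h) − X𝔖_h| ≤ K X V η^{δ−1}` for `X = q^V`, `V ≥ 10 log η` (instance
`R(η) = η^{δ−1}`: `1/η = η^{−1} ≤ η^{δ−1}` for `η ≥ 1`). [cite: MatomakiMerikoski2023, Corollary 1.1(ii)] -/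
theorem MatomakiMerikoski2023_fixedShift_ii_rpow_of_weakPairCorrelation_rpow {δ : ℝ} (hδ : 0 < δ)
    {c₀ : ℝ} (hc₀ : 0 < c₀)
    (h13 : ∀ A : ℝ, 0 < A → ∃ K : ℝ, 0 < K ∧
      ∀ (q : ℕ) [NeZero q], 2 ≤ q → ∀ χ : DirichletCharacter ℂ q, χ.IsPrimitive → χ.IsQuadratic →
        ∀ η : ℝ, 10 ≤ η → χ.LFunction ((1 - 1 / (η * Real.log q) : ℝ) : ℂ) = 0 →
          ∀ V X : ℝ, 10 ≤ V → X = (q : ℝ) ^ V → ∀ h : ℕ, 1 ≤ h → (h : ℝ) ≤ A * X →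
            |(∑ n ∈ Icc 1 ⌊X⌋₊, Λ n * Λ (n + h)) -
                X * Literature.NumberTheory.Sieve.goldbachSingularSeries h *
                  (1 + if Nat.totient (2 ^ padicValNat 2 q) ∣ h then
                        (-1 : ℝ) ^ (h / Nat.totient (2 ^ padicValNat 2 q)) *
                          ∏ p ∈ (q / 2 ^ padicValNat 2 q).primeFactors.filter (fun p => ¬ p ∣ h),
                            (-1 : ℝ) / ((p : ℝ) - 2)
                      else 0)| ≤
              K * ((h : ℝ) / (Nat.totient h : ℝ)) * X *
                (Real.exp (-1 * Real.sqrt (V * Real.log η)) +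
                  Real.exp (-c₀ * Real.sqrt (Real.log X)) + V * η ^ (δ - 1))) :
    ∀ h : ℕ, 1 ≤ h → ∃ K : ℝ, 0 < K ∧
      ∀ (q : ℕ) [NeZero q], 2 ≤ q → ∀ χ : DirichletCharacter ℂ q, χ.IsPrimitive → χ.IsQuadratic →
        ∀ η : ℝ, 10 ≤ η → χ.LFunction ((1 - 1 / (η * Real.log q) : ℝ) : ℂ) = 0 →
          ∀ V X : ℝ, 10 * Real.log η ≤ V → X = (q : ℝ) ^ V →
            |(∑ n ∈ Icc 1 ⌊X⌋₊, Λ n * Λ (n + h)) -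
                X * Literature.NumberTheory.Sieve.goldbachSingularSeries h| ≤
              K * X * (V * η ^ (δ - 1)) := by
  have hR : ∀ η : ℝ, 10 ≤ η → 1 / η ≤ 1 * (fun t : ℝ => t ^ (δ - 1)) η := by
    intro η hη
    have hη1 : (1 : ℝ) ≤ η := by linarith
    have hη0 : 0 < η := by linarith
    rw [one_mul]
    show 1 / η ≤ η ^ (δ - 1)
    rw [one_div, ← Real.rpow_neg_one]
    exact Real.rpow_le_rpow_of_exponent_le hη1 (by linarith)
  exact MatomakiMerikoski2023_fixedShift_ii_generic_of_weakPairCorrelation_generic one_pos hR hc₀ h13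

end Literature.Barriers.Parity

end
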